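import Summits.ResolutionOfSingularities.ResolutionOfSingularities.Theorems.RadicialJungCleanModelsT2BlowupStalkChart
import HarnessLib

/-!
# Route `RadicialJung`, crux `CleanModels` (stmt-15917): the local rings of a point blow-up as
# localised charts — fraction field, the algebra structure on the stalk, maximality of the
# centre (T2 brick B5-a, part 2)

Support file (OURS) for PROGRAMME-clean-dim2 / T2, continuation of
`RadicialJungCleanModelsT2BlowupStalkChart.lean` (the scheme → chart bridge), in the shapes asked by
res-L0-w81-pv-1 g10 (STATUS 20:37:08Z) for `stub_lemma23`. Nothing here is a statement of
Hironaka's manuscript.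

With `R = im(𝒪_{X,π x′} → K(X))`, `T = im(ε_{x′})`, `A = R[v/u]` (`chartAdjoin u v`) for generators
`(u, v)` of `𝔪_{π x′}` and `Q = 𝔪_T ∩ A`:

* `isFractionRing_range_stalk`, `isFractionRing_range_stalkEmb` — `Frac R = Frac T = K(X)`
  (for pv-2's (C1)/(C2), `RadicialJungCleanModelsLogContentIdealBlowup.lean`);
* `mem_maximalIdeal_range_stalkEmb_iff`, `chartIncl_mem_comap_maximalIdeal` — `T` dominates `R`:
  `θ r ∈ 𝔪_T ↔ r ∈ 𝔪`, so the images of `u, v` (and of every non-unit) lie in `Q`;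
* `exists_chart_algebra_isLocalization_atPrime` — in the `u`-chart there is `χ : A → 𝒪_{X₁,x′}`,
  compatible with `ε_{x′}`, presenting the STALK ITSELF as `A_Q`
  (`[Algebra (chartAdjoin u v) 𝒪_{X₁,x′}] [IsLocalization.AtPrime 𝒪_{X₁,x′} Q]`, the format of
  `length_quotient_mul_length_atPrime_weakTransform_add_le` of
  `RadicialJungCleanModelsGiraudPointBound.lean`);
* `isMaximal_comap_maximalIdeal_chartAdjoin` — `Q` is a MAXIMAL ideal of `A` when `𝒪_{X,π x′}`
  and `𝒪_{X₁,x′}` are two-dimensional (e.g. closed points of regular surfaces): `dim A ≤ 2`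
  (`ringKrullDim_chartAdjoin_le`) and `ht Q = dim A_Q = dim 𝒪_{X₁,x′} = 2`.

## References
* C. Huneke, I. Swanson, Integral Closure of Ideals, Rings, and Modules (2006), §14.2.
  [HunekeSwanson2006]
* The Stacks Project, Tag 0804. [StacksProject]
-/

noncomputable section

set_option linter.dupNamespace false -- mandated namespace of this single-conjunct summit

open CategoryTheory AlgebraicGeometry TopologicalSpace IsLocalRing
open Literature.AlgebraicGeometry.Resolution

namespace Summit.ResolutionOfSingularities.ResolutionOfSingularities.Theorems.RadicialJung.CleanModels.T2

universe u

open Scheme.IdealSheafData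

variable {X₁ X : Scheme.{u}} [IsIntegral X] [IsLocallyNoetherian X] {π : X₁ ⟶ X}
  {J : X.IdealSheafData}

/-! ## Fraction fields -/

omit [IsLocallyNoetherian X] in
/-- `K(X)` is the fraction field of the image `R` of `𝒪_{X,s}`. [folklore] -/
theorem isFractionRing_range_stalk (s : X) :
    IsFractionRing (algebraMap (X.presheaf.stalk s) X.functionField).range X.functionField := by
  refine IsFractionRing.of_field _ _ fun z => ?_
  obtain ⟨a, b, -, rfl⟩ := IsFractionRing.div_surjective (A := X.presheaf.stalk s) z
  exact ⟨⟨_, a, rfl⟩, ⟨_, b, rfl⟩, rfl⟩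

/-- `K(X)` is the fraction field of the image `T` of `𝒪_{X₁,x′}` (it contains `R`). [folklore] -/
theorem isFractionRing_range_stalkEmb (hπ : IsBlowup π J) (x' : X₁) :
    IsFractionRing (hπ.stalkEmb x').range X.functionField := by
  refine IsFractionRing.of_field _ _ fun z => ?_
  obtain ⟨a, b, -, rfl⟩ := IsFractionRing.div_surjective (A := X.presheaf.stalk (π x')) z
  exact ⟨⟨_, range_algebraMap_le_range_stalkEmb hπ x' ⟨a, rfl⟩⟩,
    ⟨_, range_algebraMap_le_range_stalkEmb hπ x' ⟨b, rfl⟩⟩, rfl⟩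

/-! ## Domination: which elements of `R` and of the chart lie in the centre `Q` -/

/-- `θ r ∈ 𝔪_T ↔ r ∈ 𝔪_{π x′}`: `T` dominates `R` (`π^♯_{x′}` is local). [folklore] -/
theorem mem_maximalIdeal_range_stalkEmb_iff (hπ : IsBlowup π J) (x' : X₁)
    (r : X.presheaf.stalk (π x')) :
    haveI := isLocalRing_range_stalkEmb hπ x'
    (⟨algebraMap _ X.functionField r, range_algebraMap_le_range_stalkEmb hπ x' ⟨r, rfl⟩⟩ :
        (hπ.stalkEmb x').range) ∈ maximalIdeal (hπ.stalkEmb x').range ↔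
      r ∈ maximalIdeal (X.presheaf.stalk (π x')) := by
  haveI := isLocalRing_range_stalkEmb hπ x'
  have h1 :
      (⟨algebraMap _ X.functionField r, range_algebraMap_le_range_stalkEmb hπ x' ⟨r, rfl⟩⟩ :
        (hπ.stalkEmb x').range) = ⟨hπ.stalkEmb x' ((π.stalkMap x').hom r), _, rfl⟩ :=
    Subtype.ext (hπ.stalkEmb_stalkMap x' r).symm
  rw [h1, mem_maximalIdeal_range_iff _ (hπ.stalkEmb_injective x'), IsLocalRing.mem_maximalIdeal,
    IsLocalRing.mem_maximalIdeal, mem_nonunits_iff, mem_nonunits_iff,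
    isUnit_map_iff (π.stalkMap x').hom r]

/-- In the `u`-chart, the images of the non-units of `𝒪_{X,π x′}` lie in the centre
`Q = 𝔪_T ∩ R[v/u]` (in particular `u, v ∈ Q`). [folklore] -/
theorem chartIncl_mem_comap_maximalIdeal (hπ : IsBlowup π J) (x' : X₁)
    (u v : X.presheaf.stalk (π x'))
    (hle : haveI := isLocalRing_range_algebraMap_stalk (X := X) (π x')
      chartAdjoin (K := X.functionField)
        (⟨algebraMap _ X.functionField u, u, rfl⟩ :
          (algebraMap (X.presheaf.stalk (π x')) X.functionField).range)
        ⟨algebraMap _ X.functionField v, v, rfl⟩ ≤ (hπ.stalkEmb x').range)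
    {r : X.presheaf.stalk (π x')} (hr : r ∈ maximalIdeal (X.presheaf.stalk (π x'))) :
    haveI := isLocalRing_range_algebraMap_stalk (X := X) (π x')
    haveI := isLocalRing_range_stalkEmb hπ x'
    chartIncl (K := X.functionField)
        (⟨algebraMap _ X.functionField u, u, rfl⟩ :
          (algebraMap (X.presheaf.stalk (π x')) X.functionField).range)
        ⟨algebraMap _ X.functionField v, v, rfl⟩ ⟨algebraMap _ X.functionField r, r, rfl⟩ ∈
      (maximalIdeal (hπ.stalkEmb x').range).comap (Subring.inclusion hle) := by
  haveI := isLocalRing_range_algebraMap_stalk (X := X) (π x')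
  haveI := isLocalRing_range_stalkEmb hπ x'
  rw [Ideal.mem_comap]
  have h : Subring.inclusion hle (chartIncl (K := X.functionField)
      (⟨algebraMap _ X.functionField u, u, rfl⟩ :
        (algebraMap (X.presheaf.stalk (π x')) X.functionField).range)
      ⟨algebraMap _ X.functionField v, v, rfl⟩ ⟨algebraMap _ X.functionField r, r, rfl⟩) =
      ⟨algebraMap _ X.functionField r, range_algebraMap_le_range_stalkEmb hπ x' ⟨r, rfl⟩⟩ :=
    Subtype.ext rfl
  rw [h]
  exact (mem_maximalIdeal_range_stalkEmb_iff hπ x' r).mpr hr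

/-! ## The stalk as the localised chart -/

/-- **The stalk `𝒪_{X₁,x′}` IS `R[v/u]_Q`**: in the `u`-chart (`R[v/u] ≤ T`, `u ≠ 0`) there is a
ring homomorphism `χ : R[v/u] → 𝒪_{X₁,x′}` with `ε_{x′} ∘ χ` the inclusion `R[v/u] ≤ K(X)`,
which presents `𝒪_{X₁,x′}` as the localisation of `R[v/u]` at `Q = 𝔪_T ∩ R[v/u]`.
[cite: HunekeSwanson2006, §14.2 (p. 264)] [cite: StacksProject, Tag 0804] -/
theorem exists_chart_algebra_isLocalization_atPrime (hπ : IsBlowup π J) (x' : X₁)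
    (hJ : stalkIdeal J (π x') = maximalIdeal (X.presheaf.stalk (π x')))
    (u v : X.presheaf.stalk (π x')) (huv : maximalIdeal (X.presheaf.stalk (π x')) = Ideal.span {u, v})
    (hu0 : u ≠ 0)
    (hle : haveI := isLocalRing_range_algebraMap_stalk (X := X) (π x')
      chartAdjoin (K := X.functionField)
        (⟨algebraMap _ X.functionField u, u, rfl⟩ :
          (algebraMap (X.presheaf.stalk (π x')) X.functionField).range)
        ⟨algebraMap _ X.functionField v, v, rfl⟩ ≤ (hπ.stalkEmb x').range) :
    haveI := isLocalRing_range_algebraMap_stalk (X := X) (π x')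
    haveI := isLocalRing_range_stalkEmb hπ x'
    ∃ χ : chartAdjoin (K := X.functionField)
        (⟨algebraMap _ X.functionField u, u, rfl⟩ :
          (algebraMap (X.presheaf.stalk (π x')) X.functionField).range)
        ⟨algebraMap _ X.functionField v, v, rfl⟩ →+* X₁.presheaf.stalk x',
      (∀ a, hπ.stalkEmb x' (χ a) = (a : X.functionField)) ∧
      @IsLocalization.AtPrime _ _ (X₁.presheaf.stalk x') _ χ.toAlgebra
        ((maximalIdeal (hπ.stalkEmb x').range).comap (Subring.inclusion hle)) _ := by
  haveI := isLocalRing_range_algebraMap_stalk (X := X) (π x')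
  haveI := isLocalRing_range_stalkEmb hπ x'
  obtain ⟨eT, heT⟩ := exists_ringEquiv_range_stalkEmb hπ x'
  have hTeq := range_stalkEmb_eq_ofPrime_chartAdjoin hπ x' hJ u v huv hu0 hle
  set A := chartAdjoin (K := X.functionField)
    (⟨algebraMap _ X.functionField u, u, rfl⟩ :
      (algebraMap (X.presheaf.stalk (π x')) X.functionField).range)
    ⟨algebraMap _ X.functionField v, v, rfl⟩ with hA
  set Q : Ideal A := (maximalIdeal (hπ.stalkEmb x').range).comap (Subring.inclusion hle) with hQ
  -- `(A_Q as a subring) = T ≅ 𝒪_{X₁,x′}`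
  let e₀ : (LocalSubring.ofPrime A Q).toSubring ≃+* (hπ.stalkEmb x').range :=
    RingEquiv.subringCongr hTeq.symm
  let χ : A →+* X₁.presheaf.stalk x' := eT.symm.toRingHom.comp (Subring.inclusion hle)
  have hχ : ∀ a, hπ.stalkEmb x' (χ a) = (a : X.functionField) := fun a => by
    have h := heT (eT.symm (Subring.inclusion hle a))
    rw [eT.apply_symm_apply] at h
    exact h.symm
  refine ⟨χ, hχ, ?_⟩
  letI := χ.toAlgebra
  have e : (LocalSubring.ofPrime A Q).toSubring ≃ₐ[A] X₁.presheaf.stalk x' :=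
    AlgEquiv.ofRingEquiv (f := e₀.trans eT.symm) fun a => by
      change eT.symm (e₀ (algebraMap A (LocalSubring.ofPrime A Q).toSubring a)) =
        eT.symm (Subring.inclusion hle a)
      congr 1
  exact IsLocalization.isLocalization_of_algEquiv Q.primeCompl e

/-! ## The centre `Q` is a maximal ideal at two-dimensional points -/

/-- **`Q = 𝔪_T ∩ R[v/u]` is a maximal ideal of `R[v/u]`** when `𝒪_{X,π x′}` and `𝒪_{X₁,x′}` are
two-dimensional (e.g. `π x′`, `x′` closed points of regular surfaces): `dim R[v/u] ≤ 2`
(`ringKrullDim_chartAdjoin_le`) while `ht Q = dim R[v/u]_Q = dim 𝒪_{X₁,x′} = 2`.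
[cite: HunekeSwanson2006, §14.2 (p. 264)] -/
theorem isMaximal_comap_maximalIdeal_chartAdjoin (hπ : IsBlowup π J) (x' : X₁)
    (hJ : stalkIdeal J (π x') = maximalIdeal (X.presheaf.stalk (π x')))
    (u v : X.presheaf.stalk (π x')) (huv : maximalIdeal (X.presheaf.stalk (π x')) = Ideal.span {u, v})
    (hu0 : u ≠ 0) (hdim : ringKrullDim (X.presheaf.stalk (π x')) = 2)
    (hdim₁ : ringKrullDim (X₁.presheaf.stalk x') = 2)
    (hle : haveI := isLocalRing_range_algebraMap_stalk (X := X) (π x')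
      chartAdjoin (K := X.functionField)
        (⟨algebraMap _ X.functionField u, u, rfl⟩ :
          (algebraMap (X.presheaf.stalk (π x')) X.functionField).range)
        ⟨algebraMap _ X.functionField v, v, rfl⟩ ≤ (hπ.stalkEmb x').range) :
    haveI := isLocalRing_range_algebraMap_stalk (X := X) (π x')
    haveI := isLocalRing_range_stalkEmb hπ x'
    ((maximalIdeal (hπ.stalkEmb x').range).comap (Subring.inclusion hle)).IsMaximal := by
  haveI := isLocalRing_range_algebraMap_stalk (X := X) (π x')
  haveI := isLocalRing_range_stalkEmb hπ x'
  obtain ⟨eR, -⟩ := exists_ringEquiv_range_stalk (X := X) (π := π) x'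
  obtain ⟨eT, -⟩ := exists_ringEquiv_range_stalkEmb hπ x'
  have hTeq := range_stalkEmb_eq_ofPrime_chartAdjoin hπ x' hJ u v huv hu0 hle
  set A := chartAdjoin (K := X.functionField)
    (⟨algebraMap _ X.functionField u, u, rfl⟩ :
      (algebraMap (X.presheaf.stalk (π x')) X.functionField).range)
    ⟨algebraMap _ X.functionField v, v, rfl⟩ with hA
  set Q : Ideal A := (maximalIdeal (hπ.stalkEmb x').range).comap (Subring.inclusion hle) with hQ
  -- `dim A ≤ 2`
  have hdimR : ringKrullDim (algebraMap (X.presheaf.stalk (π x')) X.functionField).range = 2 := by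
    rw [← ringKrullDim_eq_of_ringEquiv eR, hdim]
  have hu0' : (⟨algebraMap _ X.functionField u, u, rfl⟩ :
      (algebraMap (X.presheaf.stalk (π x')) X.functionField).range) ≠ 0 := by
    intro h
    have h' := congrArg Subtype.val h
    exact hu0 ((map_eq_zero_iff _ (IsFractionRing.injective _ _)).mp h')
  have hdimA : ringKrullDim A ≤ 2 := ringKrullDim_chartAdjoin_le hdimR hu0'
  -- `ht Q = dim A_Q = dim T = 2`
  have hhtQ : (Q.height : WithBot ℕ∞) = 2 := by
    have h1 := IsLocalization.AtPrime.ringKrullDim_eq_height Q (LocalSubring.ofPrime A Q).toSubring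
    have h2 : ringKrullDim (LocalSubring.ofPrime A Q).toSubring = 2 := by
      rw [ringKrullDim_eq_of_ringEquiv (RingEquiv.subringCongr hTeq.symm),
        ← ringKrullDim_eq_of_ringEquiv eT, hdim₁]
    exact h1.symm.trans h2
  have hle' : (Q.height : WithBot ℕ∞) ≤ ringKrullDim A :=
    Ideal.height_le_ringKrullDim_of_ne_top (Ideal.IsPrime.ne_top' (I := Q))
  -- hence `ht Q = dim A` and `Q` is maximal
  haveI : FiniteRingKrullDim A := by
    rw [finiteRingKrullDim_iff_ne_bot_and_top]
    constructor
    · intro h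
      rw [h] at hle'
      exact WithBot.not_coe_le_bot _ hle'
    · intro h
      rw [h] at hdimA
      exact absurd hdimA (by decide)
  refine Ideal.isMaximal_of_height_eq_ringKrullDim (le_antisymm hle' ?_)
  rw [hhtQ]
  exact hdimA

end Summit.ResolutionOfSingularities.ResolutionOfSingularities.Theorems.RadicialJung.CleanModels.T2

end
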